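import Summits.Ventures.YMGap.Thresholds.LatticeCorners

/-!
# Venture YMGap — Theorem C: the Hessian form of the Wilson action is bounded by `4d`

HONEST FRAMING: venture file (cell `pub-ymgap`, track (a), item A2 = "Theorem C" of
`p2/HESSIAN-SHARP.md`, referee-checked inside the cell). This file kernel-checks the LATTICE half of
Theorem C in the form of `p2/SPL-SOS.md` §3: on the discrete torus `(ℤ/L)^d` (every `L ≥ 1`, every
`d`, every `N`), for every configuration `Q` of unitary link matrices and EVERY family of link
perturbations `X_e ∈ ℂ^{N×N}`,
`|Σ_p plaqHess(Q,X,p)| ≤ 4d · Σ_e ‖X_e‖²`  (`hessianForm_le_four_d`, `neg_hessianForm_le_four_d`,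
`abs_hessianForm_le_four_d`), where `plaqHess` is (twice) the explicit second-order Taylor
coefficient of `t ↦ Re tr hol_p(e^{tX}Q)` (`LatticeCorners.plaqHess`, `SinglePlaquetteSOS.word2`;
its identification with the second derivative is `ExpWordCalculus.lean` / `WilsonHessian.lean`).
Shen–Zhu–Zhu's per-plaquette count gives `8(d-1)` here (CMP 400 (2023), Lemma 4.1); `4d` is
attained (HESSIAN-SHARP Prop. D, not in this file). What is NOT here: the Bakry–Émery consequences
(`|β| < 1/(8d)`, named T2.2/T2.3 of `p2/LEAN-TARGETS-A2.md`); no measure, threshold or mass-gap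
statement is made in this file.

## Proof (SPL-SOS §3)
Per plaquette, `plaqHess_le_corners` (`LatticeCorners.lean`) bounds `±plaqHess` by the four corner
squares `‖X̂_e(v) − X̂_{e'}(v)‖²`. Re-indexing the plaquette sum by corners (four translations of the
torus, `sum_corners_shift`) turns `Σ_p` into `Σ_v Σ_{i<j} Σ_{s,s'}` over ORTHOGONAL pairs of
edge-ends at `v`; `sum_orthPairs_le` bounds the vertex term by `2d Σ_{e∋v} ‖X_e‖²`
(`sum_siteCorner_le`), and `Σ_v Σ_{e∋v} = 2Σ_e` (`sum_endVec_sq`).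

Reference: cell files `run/shared/lean/pub/pub-ymgap/p2/SPL-SOS.md` §3, `p2/HESSIAN-SHARP.md` §1–§3.
-/

noncomputable section

namespace Summit.Ventures.YMGap.HessianSharp

open Matrix Complex Finset
open Literature.MathematicalPhysics.QuantumFieldTheory
open scoped Matrix ComplexConjugate BigOperators

variable {n : Type*} [Fintype n] [DecidableEq n] {d L : ℕ}

/-! ## Steps B–D: summing over the torus -/

variable [NeZero L]

/-- The total Hessian form as a sum over base points and ordered direction pairs `i < j`. -/
theorem hessianForm_eq_sum_ite (Q X : GaugeConfig d L (Matrix n n ℂ)) :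
    hessianForm Q X = ∑ x : Site d L, ∑ i : Fin d, ∑ j : Fin d,
      (if i < j then plaqHess Q X x i j else 0) := by
  unfold hessianForm
  rw [Fintype.sum_prod_type]
  refine Finset.sum_congr rfl fun x _ => ?_
  rw [← Finset.sum_subtype (Finset.univ.filter fun p : Fin d × Fin d => p.1 < p.2) (by simp)
    (fun p : Fin d × Fin d => plaqHess Q X x p.1 p.2), Finset.sum_filter, Fintype.sum_prod_type]

omit [Fintype n] [DecidableEq n] in
/-- Exchanging the site sum with the direction sums under the guard `i < j`. -/
theorem sum_sites_ite (F : Site d L → Fin d → Fin d → ℝ) :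
    ∑ x : Site d L, ∑ i : Fin d, ∑ j : Fin d, (if i < j then F x i j else 0)
      = ∑ i : Fin d, ∑ j : Fin d, (if i < j then ∑ x : Site d L, F x i j else 0) := by
  rw [Finset.sum_comm]
  refine Finset.sum_congr rfl fun i _ => ?_
  rw [Finset.sum_comm]
  refine Finset.sum_congr rfl fun j _ => ?_
  split_ifs with h
  · rfl
  · simp

omit [Fintype n] [DecidableEq n] in
/-- Translation invariance of site sums: `Σ_x g(x + eᵢ) = Σ_x g(x)`. -/
theorem sum_shift (i : Fin d) (g : Site d L → ℝ) : ∑ x : Site d L, g (x.shift i) = ∑ x, g x := by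
  simpa only [Site.shift, Equiv.coe_addRight] using
    Equiv.sum_comp (Equiv.addRight (Pi.single i (1 : ZMod L))) g

omit [Fintype n] [DecidableEq n] in
/-- `Σ_x g(x - eᵢ) = Σ_x g(x)`. -/
theorem sum_unshift (i : Fin d) (g : Site d L → ℝ) :
    ∑ x : Site d L, g (x - Pi.single i 1) = ∑ x, g x := by
  simpa using Equiv.sum_comp (Equiv.subRight (Pi.single i (1 : ZMod L))) g

omit [DecidableEq n] in
/-- **Step B**: the four corners of the plaquettes `(x; i, j)`, `x` running over the torus, are
the four corner types at every site (re-index each corner by its own site). -/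
theorem sum_corners_shift (Q X : GaugeConfig d L (Matrix n n ℂ)) (i j : Fin d) :
    ∑ x : Site d L, (cornerSq Q X x (i, false) (j, false)
      + cornerSq Q X (x.shift i) (j, false) (i, true)
      + cornerSq Q X ((x.shift i).shift j) (j, true) (i, true)
      + cornerSq Q X (x.shift j) (i, false) (j, true))
      = ∑ v : Site d L, siteCorner Q X v i j := by
  simp only [siteCorner, Finset.sum_add_distrib]
  have h2 := sum_shift (L := L) i (fun v => cornerSq Q X v (j, false) (i, true))
  have h3a := sum_shift (L := L) i (fun y => cornerSq Q X (y.shift j) (j, true) (i, true))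
  have h3b := sum_shift (L := L) j (fun v => cornerSq Q X v (j, true) (i, true))
  have h4 := sum_shift (L := L) j (fun v => cornerSq Q X v (i, false) (j, true))
  beta_reduce at h2 h3a h3b h4
  rw [h2, h3a, h3b, h4]

omit [DecidableEq n] [NeZero L] in
/-- **Step C**: at one site, the corner terms of all direction pairs `i < j` are bounded by
`2d Σ_a ‖X̂_a(v)‖²` (orthogonal pairs ≤ all pairs, `sum_orthPairs_le`). -/
theorem sum_siteCorner_le (Q X : GaugeConfig d L (Matrix n n ℂ)) (v : Site d L) :
    ∑ i : Fin d, ∑ j : Fin d, (if i < j then siteCorner Q X v i j else 0)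
      ≤ 2 * d * ∑ a : Fin d × Bool, frobSq (endVec Q X v a) := by
  have sy : ∀ a b, cornerSq Q X v a b = cornerSq Q X v b a := fun a b => by
    rw [cornerSq, cornerSq, ← frobSq_neg, neg_sub]
  refine le_trans (le_of_eq ?_) (sum_orthPairs_le d (endVec Q X v))
  refine Finset.sum_congr rfl fun i _ => Finset.sum_congr rfl fun j _ => ?_
  split_ifs with hij
  · rw [siteCorner, sy (j, false) (i, true), sy (j, true) (i, true)]
    simp only [Fintype.sum_bool, cornerSq]
    ring
  · rfl

/-- **Step D**: every edge has two ends: `Σ_v Σ_a ‖X̂_a(v)‖² = 2 Σ_e ‖X_e‖²` (unitary links). -/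
theorem sum_endVec_sq (Q X : GaugeConfig d L (Matrix n n ℂ))
    (hQ : ∀ e, Q e ∈ Matrix.unitaryGroup n ℂ) :
    ∑ v : Site d L, ∑ a : Fin d × Bool, frobSq (endVec Q X v a) = 2 * tangentNormSq X := by
  have hpt : ∀ v : Site d L, ∑ a : Fin d × Bool, frobSq (endVec Q X v a)
      = ∑ i : Fin d, (frobSq (X (v, i)) + frobSq (X (v - Pi.single i 1, i))) := by
    intro v
    rw [Fintype.sum_prod_type]
    refine Finset.sum_congr rfl fun i _ => ?_
    rw [Fintype.sum_bool, endVec, endVec, frobSq_neg,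
      frobSq_conj' _ _ (mul_conjTranspose_self_of_mem (hQ _)), add_comm]
  have h2 : ∑ v : Site d L, ∑ i : Fin d, frobSq (X (v - Pi.single i 1, i))
      = ∑ v : Site d L, ∑ i : Fin d, frobSq (X (v, i)) := by
    rw [Finset.sum_comm]
    conv_rhs => rw [Finset.sum_comm]
    refine Finset.sum_congr rfl fun i _ => ?_
    exact sum_unshift i (fun v => frobSq (X (v, i)))
  simp_rw [hpt, Finset.sum_add_distrib]
  rw [h2, tangentNormSq, Fintype.sum_prod_type]
  ring

/-- **Steps A–D assembled, for any plaquette functional bounded by its corners.** If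
`P x i j` is at most the four corner terms of the plaquette `(x; i, j)` for every `x, i, j`, then
`Σ_x Σ_{i<j} P x i j ≤ 4d · Σ_e ‖X_e‖²` (used with `P = plaqHess` and `P = -plaqHess`). -/
theorem sum_le_four_d_of_le_corners (Q X : GaugeConfig d L (Matrix n n ℂ))
    (hQ : ∀ e, Q e ∈ Matrix.unitaryGroup n ℂ) (P : Site d L → Fin d → Fin d → ℝ)
    (hP : ∀ x i j, P x i j ≤
      cornerSq Q X x (i, false) (j, false)
      + cornerSq Q X (x.shift i) (j, false) (i, true)
      + cornerSq Q X ((x.shift i).shift j) (j, true) (i, true)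
      + cornerSq Q X (x.shift j) (i, false) (j, true)) :
    ∑ x : Site d L, ∑ i : Fin d, ∑ j : Fin d, (if i < j then P x i j else 0)
      ≤ 4 * d * tangentNormSq X := by
  -- Step A summed
  have hA : ∑ x : Site d L, ∑ i : Fin d, ∑ j : Fin d, (if i < j then P x i j else 0)
      ≤ ∑ x : Site d L, ∑ i : Fin d, ∑ j : Fin d,
      (if i < j then
        (cornerSq Q X x (i, false) (j, false)
          + cornerSq Q X (x.shift i) (j, false) (i, true)
          + cornerSq Q X ((x.shift i).shift j) (j, true) (i, true)
          + cornerSq Q X (x.shift j) (i, false) (j, true)) else 0) := by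
    refine Finset.sum_le_sum fun x _ => Finset.sum_le_sum fun i _ => Finset.sum_le_sum fun j _ => ?_
    split_ifs with h
    · exact hP x i j
    · exact le_rfl
  -- Step B: re-index by corner sites
  have hB : ∑ x : Site d L, ∑ i : Fin d, ∑ j : Fin d,
      (if i < j then
        (cornerSq Q X x (i, false) (j, false)
          + cornerSq Q X (x.shift i) (j, false) (i, true)
          + cornerSq Q X ((x.shift i).shift j) (j, true) (i, true)
          + cornerSq Q X (x.shift j) (i, false) (j, true)) else 0)
      = ∑ v : Site d L, ∑ i : Fin d, ∑ j : Fin d, (if i < j then siteCorner Q X v i j else 0) := by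
    rw [sum_sites_ite, sum_sites_ite]
    refine Finset.sum_congr rfl fun i _ => Finset.sum_congr rfl fun j _ => ?_
    split_ifs with h
    · exact sum_corners_shift Q X i j
    · rfl
  -- Steps C and D
  calc ∑ x : Site d L, ∑ i : Fin d, ∑ j : Fin d, (if i < j then P x i j else 0)
      ≤ _ := hA
    _ = _ := hB
    _ ≤ ∑ v : Site d L, 2 * d * ∑ a : Fin d × Bool, frobSq (endVec Q X v a) :=
        Finset.sum_le_sum fun v _ => sum_siteCorner_le Q X v
    _ = 2 * d * (2 * tangentNormSq X) := by rw [← Finset.mul_sum, sum_endVec_sq Q X hQ]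
    _ = 4 * d * tangentNormSq X := by ring

/-- **Theorem C, lattice half (sharp Hessian constant `4d`)** — HESSIAN-SHARP §3 / SPL-SOS §3.
On the torus `(ℤ/L)^d` (any `L ≥ 1`, `d`, `N`), for unitary link variables `Q` and arbitrary link
perturbations `X`: `Σ_p plaqHess(Q,X,p) ≤ 4d · Σ_e ‖X_e‖²`. (Shen–Zhu–Zhu's Lemma 4.1 bound is
`8(d-1)`; by HESSIAN-SHARP Prop. D the constant `4d` is attained, so this is the exact reach of the
pointwise Bakry–Émery method, giving the window `|β| < 1/(8d)` once combined with the named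
analytic facts T2.1–T2.2 — not asserted here.) -/
theorem hessianForm_le_four_d (Q X : GaugeConfig d L (Matrix n n ℂ))
    (hQ : ∀ e, Q e ∈ Matrix.unitaryGroup n ℂ) :
    hessianForm Q X ≤ 4 * d * tangentNormSq X := by
  rw [hessianForm_eq_sum_ite]
  exact sum_le_four_d_of_le_corners Q X hQ _ (plaqHess_le_corners Q X hQ)

/-- **Two-sided version**: also `-hessianForm Q X ≤ 4d · Σ_e ‖X_e‖²` (HESSIAN-SHARP §7(b): the
window is symmetric in the sign of `β`). -/
theorem neg_hessianForm_le_four_d (Q X : GaugeConfig d L (Matrix n n ℂ))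
    (hQ : ∀ e, Q e ∈ Matrix.unitaryGroup n ℂ) :
    -hessianForm Q X ≤ 4 * d * tangentNormSq X := by
  have h := sum_le_four_d_of_le_corners Q X hQ _ (neg_plaqHess_le_corners Q X hQ)
  refine le_trans (le_of_eq ?_) h
  rw [hessianForm_eq_sum_ite, ← Finset.sum_neg_distrib]
  refine Finset.sum_congr rfl fun x _ => ?_
  rw [← Finset.sum_neg_distrib]
  refine Finset.sum_congr rfl fun i _ => ?_
  rw [← Finset.sum_neg_distrib]
  refine Finset.sum_congr rfl fun j _ => ?_
  split_ifs <;> simp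

/-- `|hessianForm Q X| ≤ 4d · Σ_e ‖X_e‖²`. -/
theorem abs_hessianForm_le_four_d (Q X : GaugeConfig d L (Matrix n n ℂ))
    (hQ : ∀ e, Q e ∈ Matrix.unitaryGroup n ℂ) :
    |hessianForm Q X| ≤ 4 * d * tangentNormSq X :=
  abs_le.mpr ⟨by linarith [neg_hessianForm_le_four_d Q X hQ], hessianForm_le_four_d Q X hQ⟩

end Summit.Ventures.YMGap.HessianSharp
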